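import Summits.Ventures.CertifiedQuantumChemistry.Rows.GapCertificateCodimOne
import Literature.MathematicalPhysics.QuantumChemistry.LevelShiftDeflation
import HarnessLib

/-!
# Ventures/CertifiedQuantumChemistry — Rows/LevelShiftGapRows.lean: the LEVEL-SHIFT β-producer made
# concrete — the diagonal weight table file `F_w`, its Hamiltonian `Σ_p w_p E_pp − μ`, the occupation
# bound off the reference determinant, and `LowerRow (F + λF_w) ⇒ GapCertificateCodimOne F`

HONEST FRAMING (verbatim): certified bounds for a stated model Hamiltonian in a stated basis; not a
claim about the real molecule or material beyond that model.

Typer chem-type-02 (LADDER-CHEM I-TYPE slot 02c «door-M1 gap-producer soundness», cell chem-oracle;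
chem-idea-1 2026-08-26T21:39:46Z (R2) / 21:40:54Z «β-PRODUCER OF RECORD = LEVEL-SHIFT DEFLATION»).
Composition of TREE results only — nothing is asserted about any file:
* chem-type-09's producer `gapCertificateCodimOne_of_lowerRow_shift` (`Rows/GapCertificateCodimOne.lean`):
  an ordinary lower row `ℓ ≤ E₀(Ĥ(F + λS); a, b)` plus a form bound `Re⟨x, Ĥ(S)x⟩ ≤ c‖x‖²` on the
  sector vectors orthogonal to one vector `v` gives `GapCertificateCodimOne F a b (ℓ − λc)`;
* the Literature occupation bounds (`LevelShiftDeflation.lean`, this seat): the spin-free weighted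
  number operator `G_w = Σ_p w_p E_pp` is `≤ M − δ` on the `(a, b)` sector orthogonally to the reference
  determinant `|D⋆⟩ = |T_α↑ T_β↓⟩` when `T_α`, `T_β` win their sizes by the margin `δ`.

## Contents
* `Model.diagWeight w μ` — the WEIGHT TABLE FILE `F_w`: `h = diag(w)`, `eri = 0`, `ecore = −μ`
  (chem-idea-1's 12-line weight FCIDUMP; the shifted file of the pipeline is the exact combination
  `Model.lincomb 1 λ F (Model.diagWeight w μ)`, i.e. `h_pp ↦ h_pp + λw_p`, `E_core ↦ E_core − λμ`,
  `eri` unchanged — `levelShift_h/_eri/_ecore`); `diagWeight_isSymmetric`;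
  `hamiltonian_diagWeight : Ĥ(F_w) = Σ_p w_p E_pp − μ·1`.
* `sum_add_le_sum_of_thresholds` — the DECIDABLE discharge of the margin hypothesis: weights `≥ lo`
  inside `T`, `≤ hi` outside, `hi ≤ lo` ⇒ every other set of size `|T|` loses by `≥ lo − hi`
  (`k` comparisons instead of `C(k, |T|)` subsets); `forall_ne_of_card_eq_vacuous` for an empty or full
  spin channel.
* `diagWeight_form_le_on_orth_det` — `Re⟨x, Ĥ(F_w)x⟩ ≤ (M − δ − μ)‖x‖²` for sector vectors `x ⊥ |D⋆⟩`
  (the `hSform` input of the producer).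
* **`gapCertificateCodimOne_of_lowerRow_levelShift`** — `LowerRow (lincomb 1 λ F (diagWeight w μ)) a b ℓ`
  with the margin hypotheses ⇒ `GapCertificateCodimOne F a b (ℓ − λ(M − δ − μ))`; threshold form
  `…_of_thresholds`; CLOSED-SHELL form `gapCertificateCodimOne_of_lowerRow_closedShell` (`w = 1_J`,
  `a = b = |J|`, `δ = 1`, `M = 2|J| = N`: `c = N − 1 − μ`), which is the STEP-0 object (N₂/STO-6G, `J` =
  the 7 aufbau orbitals, `c = 13`).

Downstream (unchanged): `GapCertificateCodimOne.gapCertificate` ⇒ `lowerRow_of_temple` /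
`CIVec.lowerRow_of_temple_gapCertificate` (Temple lower rows), `TempleKato.sector_enclosure`.

What is NOT here: any certificate instance or claim node (the STEP-0 legs are filed by chem-idea-1 /
chem-solver-4 from refereed cells); the unique-maximiser check is replaced by the weaker-but-sufficient
margin/threshold hypotheses (a zero margin gives a true but useless certificate, never a false one).
-/

noncomputable section

namespace Summit.Ventures.CertifiedQuantumChemistry

open Matrix Finset
open Literature.MathematicalPhysics.QuantumLattice Literature.MathematicalPhysics.QuantumChemistry
open Literature.MathematicalPhysics.QuantumLattice.EigenvalueContinuation
open scoped ComplexOrder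

variable {k : ℕ}

/-! ## §1 The weight table file `F_w` -/

/-- **The diagonal weight table file** `F_w = Model.diagWeight w μ`: one-electron table `diag(w)`, no
two-electron integrals, core constant `−μ`. Its Hamiltonian is the spin-free weighted number operator
`Σ_p w_p E_pp − μ` (`hamiltonian_diagWeight`). The level-shifted file of a model `F` is
`Model.lincomb 1 λ F (Model.diagWeight w μ)`. -/
def Model.diagWeight (w : Fin k → ℚ) (μ : ℚ) : Model k where
  h p q := if p = q then w p else 0
  eri _ _ _ _ := 0
  ecore := -μ

/-- Tables of the weight file (by definition). -/
@[simp] theorem Model.diagWeight_h (w : Fin k → ℚ) (μ : ℚ) (p q : Fin k) :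
    (Model.diagWeight w μ).h p q = if p = q then w p else 0 := rfl

/-- Tables of the weight file (by definition). -/
@[simp] theorem Model.diagWeight_eri (w : Fin k → ℚ) (μ : ℚ) (p q r s : Fin k) :
    (Model.diagWeight w μ).eri p q r s = 0 := rfl

/-- Tables of the weight file (by definition). -/
@[simp] theorem Model.diagWeight_ecore (w : Fin k → ℚ) (μ : ℚ) : (Model.diagWeight w μ).ecore = -μ := rfl

/-- The weight file is symmetric (diagonal `h`, zero `eri`). -/
theorem Model.diagWeight_isSymmetric (w : Fin k → ℚ) (μ : ℚ) : (Model.diagWeight w μ).IsSymmetric := by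
  refine ⟨fun p q => ?_, fun p q r s => rfl⟩
  simp only [Model.diagWeight_h]
  by_cases h : p = q
  · subst h; rfl
  · rw [if_neg h, if_neg (Ne.symm h)]

/-- The level-shifted file's tables: `h_pq + λ[p = q]w_p`, `eri` unchanged, `E_core − λμ`
(what reader C re-derives from the parent pin, `w`, `λ`, `μ`). -/
theorem Model.levelShift_h (F : Model k) (lam : ℚ) (w : Fin k → ℚ) (μ : ℚ) (p q : Fin k) :
    (Model.lincomb 1 lam F (Model.diagWeight w μ)).h p q = F.h p q + lam * (if p = q then w p else 0) := by
  simp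

/-- The level-shifted file's two-electron table is the parent's. -/
theorem Model.levelShift_eri (F : Model k) (lam : ℚ) (w : Fin k → ℚ) (μ : ℚ) (p q r s : Fin k) :
    (Model.lincomb 1 lam F (Model.diagWeight w μ)).eri p q r s = F.eri p q r s := by
  simp

/-- The level-shifted file's core constant is `E_core − λμ`. -/
theorem Model.levelShift_ecore (F : Model k) (lam : ℚ) (w : Fin k → ℚ) (μ : ℚ) :
    (Model.lincomb 1 lam F (Model.diagWeight w μ)).ecore = F.ecore - lam * μ := by
  simp; ring

/-- **`Ĥ(F_w) = Σ_p w_p E_pp − μ·1`**: the second-quantised Hamiltonian of the weight file is the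
spin-free weighted number operator shifted by `−μ` (`molecularHamiltonian_eq` with a diagonal `h` and
zero `eri`). -/
theorem Model.hamiltonian_diagWeight (w : Fin k → ℚ) (μ : ℚ) :
    (Model.diagWeight w μ).hamiltonian =
      ∑ p, (((w p : ℚ) : ℝ) : ℂ) • singletExcitation p p -
        ((μ : ℚ) : ℂ) • (1 : Matrix (Finset (Orb (Fin k))) (Finset (Orb (Fin k))) ℂ) := by
  have hc : ∀ p q : Fin k,
      (((if p = q then w p else 0 : ℚ)) : ℂ) = if p = q then ((w p : ℚ) : ℂ) else 0 := by
    intro p q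
    split_ifs <;> simp
  rw [Model.hamiltonian, molecularHamiltonian_eq]
  simp only [Model.diagWeight_h, Model.diagWeight_eri, Model.diagWeight_ecore, Rat.cast_zero,
    zero_smul, Finset.sum_const_zero, smul_zero, add_zero, hc, ite_smul, Finset.sum_ite_eq,
    Finset.mem_univ, if_true, Rat.cast_neg, neg_smul, ← sub_eq_add_neg, singletExcitation,
    Complex.ofReal_ratCast]

/-- The form of `Ĥ(F_w)`: `Re⟨x, Ĥ(F_w)x⟩ = Re⟨x, G_w x⟩ − μ‖x‖²`. -/
theorem Model.re_rayleigh_diagWeight (w : Fin k → ℚ) (μ : ℚ) (x : Fock (Orb (Fin k))) :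
    (star x ⬝ᵥ (Model.diagWeight w μ).hamiltonian *ᵥ x).re =
      (star x ⬝ᵥ (∑ p, (((w p : ℚ) : ℝ) : ℂ) • singletExcitation p p) *ᵥ x).re -
        ((μ : ℚ) : ℝ) * (star x ⬝ᵥ x).re := by
  rw [Model.hamiltonian_diagWeight, sub_mulVec, smul_mulVec, one_mulVec, dotProduct_sub,
    dotProduct_smul, smul_eq_mul, Complex.sub_re, ← Complex.ofReal_ratCast, Complex.re_ofReal_mul]

/-! ## §2 Discharging the margin hypothesis from weight thresholds -/

/-- **Threshold ⇒ margin.** If every weight inside `T` is `≥ lo`, every weight outside `T` is `≤ hi`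
and `hi ≤ lo`, then every OTHER set `α` with `|α| = |T|` satisfies `Σ_{p∈α} w_p + (lo − hi) ≤ Σ_{p∈T} w_p`
(the `m ≥ 1` elements of `α ∖ T` weigh `≤ m·hi`, those of `T ∖ α` weigh `≥ m·lo`). For literal weight
vectors the three hypotheses close by `decide` / `norm_num` (`k` comparisons). -/
theorem sum_add_le_sum_of_thresholds {ι : Type*} [DecidableEq ι] {w : ι → ℚ} {T α : Finset ι}
    {lo hi : ℚ} (hlo : ∀ p ∈ T, lo ≤ w p) (hhi : ∀ p ∉ T, w p ≤ hi) (hhl : hi ≤ lo)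
    (hcard : α.card = T.card) (hne : α ≠ T) :
    ∑ p ∈ α, w p + (lo - hi) ≤ ∑ p ∈ T, w p := by
  have hsplitα : ∑ p ∈ α, w p = ∑ p ∈ α ∩ T, w p + ∑ p ∈ α \ T, w p :=
    (Finset.sum_inter_add_sum_sdiff α T w).symm
  have hsplitT : ∑ p ∈ T, w p = ∑ p ∈ T ∩ α, w p + ∑ p ∈ T \ α, w p :=
    (Finset.sum_inter_add_sum_sdiff T α w).symm
  have hm : (α \ T).card = (T \ α).card := by
    have h1 := Finset.card_sdiff_add_card_inter α T
    have h2 := Finset.card_sdiff_add_card_inter T α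
    rw [Finset.inter_comm T α] at h2
    omega
  have hmpos : 1 ≤ (α \ T).card := by
    rw [Nat.one_le_iff_ne_zero]
    intro h0
    rw [Finset.card_eq_zero, Finset.sdiff_eq_empty_iff_subset] at h0
    exact hne (Finset.eq_of_subset_of_card_le h0 hcard.ge)
  have hout : ∑ p ∈ α \ T, w p ≤ (α \ T).card * hi := by
    have h := Finset.sum_le_sum fun p (hp : p ∈ α \ T) => hhi p (Finset.mem_sdiff.1 hp).2
    rwa [Finset.sum_const, nsmul_eq_mul] at h
  have hin : ((T \ α).card : ℚ) * lo ≤ ∑ p ∈ T \ α, w p := by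
    have h := Finset.sum_le_sum fun p (hp : p ∈ T \ α) => hlo p (Finset.mem_sdiff.1 hp).1
    rwa [Finset.sum_const, nsmul_eq_mul] at h
  rw [hsplitα, hsplitT, Finset.inter_comm T α]
  have hmR : ((α \ T).card : ℚ) = (T \ α).card := by exact_mod_cast hm
  have hm1 : (1 : ℚ) ≤ ((T \ α).card : ℚ) := by rw [← hmR]; exact_mod_cast hmpos
  rw [hmR] at hout
  have key : lo - hi ≤ ((T \ α).card : ℚ) * (lo - hi) :=
    le_mul_of_one_le_left (sub_nonneg.2 hhl) hm1
  linarith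

/-- **Empty or full spin channel**: if `T = ∅` or `T = univ` there is no other set of its size, so the
margin hypothesis holds vacuously (any `δ`). -/
theorem forall_ne_of_card_eq_vacuous {ι : Type*} [Fintype ι] {T : Finset ι} (hT : T = ∅ ∨ T = Finset.univ)
    {P : Finset ι → Prop} : ∀ α : Finset ι, α.card = T.card → α ≠ T → P α := by
  intro α hcard hne
  exfalso
  rcases hT with rfl | rfl
  · exact hne (Finset.card_eq_zero.1 (by simpa using hcard))
  · exact hne (Finset.eq_univ_of_card α (by rw [hcard, Finset.card_univ]))

/-- Casting the rational margin hypothesis to the real one used by the Literature lemma. -/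
private theorem margin_cast {w : Fin k → ℚ} {T : Finset (Fin k)} {δ : ℚ}
    (h : ∀ α : Finset (Fin k), α.card = T.card → α ≠ T → ∑ p ∈ α, w p + δ ≤ ∑ p ∈ T, w p) :
    ∀ α : Finset (Fin k), α.card = T.card → α ≠ T →
      ∑ p ∈ α, ((w p : ℚ) : ℝ) + (δ : ℝ) ≤ ∑ p ∈ T, ((w p : ℚ) : ℝ) := by
  intro α hcard hne
  have := h α hcard hne
  exact_mod_cast this

/-! ## §3 The occupation bound for `Ĥ(F_w)` and the level-shift gap certificate -/

/-- **`Ĥ(F_w) ≤ M − δ − μ` orthogonally to the reference determinant.** For `T_α` (`|T_α| = a`),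
`T_β` (`|T_β| = b`) winning their sizes by the margin `δ ≥ 0`, `M = Σ_{T_α} w + Σ_{T_β} w` and
`D⋆ = pairSet T_α T_β`: every `(a, b)`-sector vector `x` with `⟨D⋆|x⟩ = 0` has
`Re⟨x, Ĥ(diagWeight w μ)x⟩ ≤ (M − δ − μ)‖x‖²` — the hypothesis `hSform` of
`gapCertificateCodimOne_of_lowerRow_shift` (`LevelShiftDeflation.weightedNumber_form_le_on_orth_det`). -/
theorem diagWeight_form_le_on_orth_det {w : Fin k → ℚ} {μ : ℚ} {a b : ℕ} {Tα Tβ : Finset (Fin k)}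
    (hTa : Tα.card = a) (hTb : Tβ.card = b) {δ : ℚ} (hδ : 0 ≤ δ)
    (hα : ∀ α : Finset (Fin k), α.card = Tα.card → α ≠ Tα → ∑ p ∈ α, w p + δ ≤ ∑ p ∈ Tα, w p)
    (hβ : ∀ β : Finset (Fin k), β.card = Tβ.card → β ≠ Tβ → ∑ p ∈ β, w p + δ ≤ ∑ p ∈ Tβ, w p) :
    ∀ x : Fock (Orb (Fin k)), IsInSector a b x → star (Pi.single (pairSet Tα Tβ) (1 : ℂ)) ⬝ᵥ x = 0 →
      (star x ⬝ᵥ (Model.diagWeight w μ).hamiltonian *ᵥ x).re ≤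
        (((∑ p ∈ Tα, w p + ∑ p ∈ Tβ, w p - δ - μ : ℚ)) : ℝ) * (star x ⬝ᵥ x).re := by
  intro x hx h0
  have h := weightedNumber_form_le_on_orth_det (w := fun p => ((w p : ℚ) : ℝ)) hTa hTb
    (show (0 : ℝ) ≤ δ by exact_mod_cast hδ) (margin_cast hα) (margin_cast hβ) x hx h0
  rw [Model.re_rayleigh_diagWeight]
  push_cast at h ⊢
  linarith

/-- **THE LEVEL-SHIFT GAP CERTIFICATE (margin form).** For a symmetric model `F`, `λ ≥ 0`, weights `w`
with reference sets `T_α` (`|T_α| = a`), `T_β` (`|T_β| = b`) winning by the margin `δ ≥ 0`, and any `μ`: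
an ordinary certified lower row `LowerRow (Model.lincomb 1 λ F (Model.diagWeight w μ)) a b ℓ` of the
level-shifted file gives `GapCertificateCodimOne F a b (ℓ − λ(M − δ − μ))`, `M = Σ_{T_α} w + Σ_{T_β} w`
(chem-type-09's `gapCertificateCodimOne_of_lowerRow_shift` with `S = F_w`, `v = |T_α↑ T_β↓⟩`). -/
theorem gapCertificateCodimOne_of_lowerRow_levelShift {F : Model k} (hF : F.IsSymmetric) {a b : ℕ}
    {lam : ℚ} (hlam : 0 ≤ lam) {w : Fin k → ℚ} {μ : ℚ} {Tα Tβ : Finset (Fin k)} (hTa : Tα.card = a)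
    (hTb : Tβ.card = b) {δ : ℚ} (hδ : 0 ≤ δ)
    (hα : ∀ α : Finset (Fin k), α.card = Tα.card → α ≠ Tα → ∑ p ∈ α, w p + δ ≤ ∑ p ∈ Tα, w p)
    (hβ : ∀ β : Finset (Fin k), β.card = Tβ.card → β ≠ Tβ → ∑ p ∈ β, w p + δ ≤ ∑ p ∈ Tβ, w p)
    {ℓ : ℚ} (hL : LowerRow (Model.lincomb 1 lam F (Model.diagWeight w μ)) a b ℓ) :
    GapCertificateCodimOne F a b (ℓ - lam * (∑ p ∈ Tα, w p + ∑ p ∈ Tβ, w p - δ - μ)) :=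
  gapCertificateCodimOne_of_lowerRow_shift hF (Model.diagWeight_isSymmetric w μ) hlam
    (Pi.single (pairSet Tα Tβ) (1 : ℂ)) (diagWeight_form_le_on_orth_det hTa hTb hδ hα hβ) hL

/-- **THE LEVEL-SHIFT GAP CERTIFICATE (threshold form — all hypotheses decidable on literal data).**
As above with the margin discharged from thresholds: inside `T_α` the weights are `≥ loα`, outside
`≤ hiα`, `hiα ≤ loα` (and likewise for `T_β`); the certified level is
`ℓ − λ(M − min(loα − hiα, loβ − hiβ) − μ)`. When `b = 0` (or a channel is full) take that channel's
thresholds with `lo − hi` as large as the other channel's margin via `…_levelShift` and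
`forall_ne_of_card_eq_vacuous` instead. -/
theorem gapCertificateCodimOne_of_lowerRow_levelShift_thresholds {F : Model k} (hF : F.IsSymmetric)
    {a b : ℕ} {lam : ℚ} (hlam : 0 ≤ lam) {w : Fin k → ℚ} {μ : ℚ} {Tα Tβ : Finset (Fin k)}
    (hTa : Tα.card = a) (hTb : Tβ.card = b) {loα hiα loβ hiβ : ℚ}
    (hloα : ∀ p ∈ Tα, loα ≤ w p) (hhiα : ∀ p ∉ Tα, w p ≤ hiα) (hα : hiα ≤ loα)
    (hloβ : ∀ p ∈ Tβ, loβ ≤ w p) (hhiβ : ∀ p ∉ Tβ, w p ≤ hiβ) (hβ : hiβ ≤ loβ)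
    {ℓ : ℚ} (hL : LowerRow (Model.lincomb 1 lam F (Model.diagWeight w μ)) a b ℓ) :
    GapCertificateCodimOne F a b
      (ℓ - lam * (∑ p ∈ Tα, w p + ∑ p ∈ Tβ, w p - min (loα - hiα) (loβ - hiβ) - μ)) := by
  refine gapCertificateCodimOne_of_lowerRow_levelShift hF hlam hTa hTb
    (le_min (sub_nonneg.2 hα) (sub_nonneg.2 hβ)) (fun α hcard hne => ?_) (fun β hcard hne => ?_) hL
  · have h := sum_add_le_sum_of_thresholds hloα hhiα hα hcard hne
    have hm : min (loα - hiα) (loβ - hiβ) ≤ loα - hiα := min_le_left _ _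
    linarith
  · have h := sum_add_le_sum_of_thresholds hloβ hhiβ hβ hcard hne
    have hm : min (loα - hiα) (loβ - hiβ) ≤ loβ - hiβ := min_le_right _ _
    linarith

/-- The indicator weight of an orbital set `J`. -/
private theorem sum_indicator_eq_card (J T : Finset (Fin k)) (hT : T = J) :
    ∑ p ∈ T, (if p ∈ J then (1 : ℚ) else 0) = J.card := by
  subst hT
  rw [Finset.sum_boole, Finset.filter_true_of_mem fun p hp => hp]

/-- **CLOSED-SHELL LEVEL SHIFT** (the STEP-0 object: `J` = the doubly occupied reference orbitals,
`a = b = |J|`, `w = 1_J`, so `F + λF_w` raises `h_pp` by `λ` on `J` and lowers `E_core` by `λμ`):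
`LowerRow (Model.lincomb 1 λ F (Model.diagWeight 1_J μ)) |J| |J| ℓ ⇒
GapCertificateCodimOne F |J| |J| (ℓ − λ(2|J| − 1 − μ))` — with `μ = 2|J| − 1 = N − 1` the level is `ℓ`
itself (`N̂_{J↑J↓} − (N − 1) ≤ |D_J⟩⟨D_J|` on the sector, chem-idea-1's closed-shell instance
`c = N − 1`). -/
theorem gapCertificateCodimOne_of_lowerRow_closedShell {F : Model k} (hF : F.IsSymmetric) {lam : ℚ}
    (hlam : 0 ≤ lam) (J : Finset (Fin k)) (μ : ℚ) {ℓ : ℚ}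
    (hL : LowerRow (Model.lincomb 1 lam F
      (Model.diagWeight (fun p => if p ∈ J then (1 : ℚ) else 0) μ)) J.card J.card ℓ) :
    GapCertificateCodimOne F J.card J.card (ℓ - lam * (2 * J.card - 1 - μ)) := by
  have h := gapCertificateCodimOne_of_lowerRow_levelShift_thresholds hF hlam
    (w := fun p => if p ∈ J then (1 : ℚ) else 0) (μ := μ) (Tα := J) (Tβ := J) rfl rfl
    (loα := 1) (hiα := 0) (loβ := 1) (hiβ := 0)
    (fun p hp => by simp [hp]) (fun p hp => by simp [hp]) zero_le_one
    (fun p hp => by simp [hp]) (fun p hp => by simp [hp]) zero_le_one hL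
  rw [sum_indicator_eq_card J J rfl] at h
  convert h using 2
  rw [min_self]
  ring

end Summit.Ventures.CertifiedQuantumChemistry

end
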